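import Literature.Computability.Complexity.SparseSetsUpwardSeparationProofs
import Literature.Computability.Complexity.NTIMEPadding
import Literature.Computability.Complexity.ExpClosure
import Literature.Computability.Complexity.ExpTimeMaps
import HarnessLib

/-!
# `EXP ≠ NEXP ⟹ P ≠ NP` (Arora–Barak 2009, Thm. 2.22): upward padding in the tree's classes

Literature / complexity toolkit (problem `PneNP`; frame fact of route DelsarteLasserre,
`Summit.PneNP.PneNP.Theses.DelsarteLasserre.NexpSubsetExpOfNpSubsetP`, stmt-PneNP-2131, and the
calibration "`EXP ≠ NEXP` is a hypothesis ABOVE `P ≠ NP`"). Arora–Barak, *Computational Complexity*,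
Thm. 2.22: "If `EXP ≠ NEXP` then `P ≠ NP`", proved by padding ("translating upward"). In the tree's
one-constant verifier form of `NTIME` the padding is assembled from proved lemmas:

* `NEXP_subset_EXP_of_NP_subset_P` — for `L ∈ NTIME(2^{nᵏ})`, `padPre k L ∈ NTIME(2ⁿ) ⊆ NE`
  (`padPre_mem_NTIME_two_pow`); under `NP ⊆ P` every tally `NP` language is in `P`, so `NE ⊆ E`
  (Book 1974, Thm. 1 (ii) ⇒ (i), `Book1974.NE_subset_E_of_tally_NP_subset_P`); hence
  `padPre k L ∈ E ⊆ EXP` and `L ≤ₚ padPre k L` (`karpReducible_padPre`) gives `L ∈ EXP`;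
* `EXP_eq_NEXP_of_P_eq_NP`, and the printed contrapositive `P_ne_NP_of_EXP_ne_NEXP`.

All proved; no named fact, no definition.

## References

* S. Arora, B. Barak, *Computational Complexity: A Modern Approach*, CUP 2009, §2.6.2, Thm. 2.22
  [AroraBarak2009].
* R. V. Book, *Tally languages and complexity classes*, Information and Control 26 (1974), Thm. 1
  [Book1974].
-/

namespace Literature.Computability.Complexity

open Nondeterministic

/-- **`NP ⊆ P ⟹ NEXP ⊆ EXP`** (upward padding through Book's tally translation).
[cite: AroraBarak2009, §2.6.2 (Thm. 2.22)] [cite: Book1974, Theorem 1 (p. 189)] -/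
theorem NEXP_subset_EXP_of_NP_subset_P (h : NP ⊆ Classes.P) : NEXP ⊆ EXP := by
  have hNE : NE ⊆ E := Book1974.NE_subset_E_of_tally_NP_subset_P fun L _ hL => h hL
  intro L hL
  simp only [NEXP, Set.mem_iUnion] at hL
  obtain ⟨k, hk⟩ := hL
  have h₀ : padPre k L ∈ NE := by
    simp only [NE, Set.mem_iUnion]
    exact ⟨1, by simpa only [one_mul] using padPre_mem_NTIME_two_pow hk⟩
  exact mem_EXP_of_karpReducible (karpReducible_padPre k L) (E_subset_EXP (hNE h₀))

/-- **`P = NP ⟹ EXP = NEXP`.** [cite: AroraBarak2009, §2.6.2 (Thm. 2.22)] -/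
theorem EXP_eq_NEXP_of_P_eq_NP (h : Classes.P = NP) : EXP = NEXP :=
  Set.Subset.antisymm EXP_subset_NEXP (NEXP_subset_EXP_of_NP_subset_P h.symm.subset)

/-- **Arora–Barak 2009, Thm. 2.22 as printed: "If `EXP ≠ NEXP` then `P ≠ NP`."**
[cite: AroraBarak2009, Thm. 2.22] -/
theorem P_ne_NP_of_EXP_ne_NEXP (h : EXP ≠ NEXP) : Classes.P ≠ NP :=
  fun hc => h (EXP_eq_NEXP_of_P_eq_NP hc)

end Literature.Computability.Complexity
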